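import Summits.RiemannHypothesis.RiemannHypothesis.Theorems.Splittings.JensenDerivativeLadder
import Literature.NumberTheory.LFunctions.XiDerivPositiveAxis
import Literature.NumberTheory.LFunctions.DeBruijnHZeroProofs
import Mathlib

/-!
# Splittings — X-4 × NEWMAN dictionary: conjunct `A = RowsFromOne` of X-4 ⟺ «`H_0′` has only real zeros»
# (SPLIT-jen-neg gen 4; zero-definition raw form)

Cell rh-split (brief sha16 f79c5f09d8bcb036), seat rh-split-jen-neg g4, card `run/shared/lean/pub/rh-split/cards/SPLIT-jen-neg.md`
ADDENDUM 5 (booked 03:01Z); carved VERBATIM from `HOME/rh-split-jen-neg/g4/SketchG4Dict.lean` (sha16 b63b4e5b0694af25, 95 l,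
zero defs, zero sorry; re-namespaced `…Splittings.JensenX4NewmanDict`) by rh-split-typer-2 g3 on the lead's queue 03:14Z item (1)
(content PASS 03:07:43Z; Theorems side routing).  The hypothesis `newmanDeriv` of the last theorem is the tree theorem
`Splittings.JensenX4NewmanDeriv.newmanDeriv` (`Splittings/JensenX4NewmanDeriv.lean`, same carve).  The seat's summary:

# rh-split-jen-neg g4 — dictionary: conjunct `A` of X-4 is «`H_0′` has only real zeros» (kernel; zero `def`s, zero `sorry`)

`RowsFromOne ↔ HasOnlyRealZeros (deriv (deBruijnH 0))`: with `rowsFromOne_iff_xiRowHyperbolic_one`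
(Theorems/Splittings/JensenDerivativeLadder), `xiRowHyperbolic_iff_xiDerivZerosReal` (XiJensenRows),
`H_0(z) = ξ(½ + iz/2)/8 = ξ₁(−z²/4)/8` (`deBruijnH_zero_eq_holds`, `riemannXi_eq_xiSq`), the chain rule
`H_0′(z) = −(z/16) ξ₁′(−z²/4)`, and «real zeros of `ξ₁′` are negative» (`re_neg_of_iteratedDeriv_xiSq_eq_zero_of_im_eq_zero`,
positivity of the Taylor coefficients). Combined with `JensenX4NewmanDeriv.newmanDeriv` (`∀ t < 0, H_t′` has a non-real zero):
`A` is the `t = 0` endpoint of the derivative flow, every `t < 0` member of which fails — "`A ⟺ Λ^{(1)} = 0`".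
Nothing here is a claim about the truth of RH.

HONEST LABEL: «SPLITTING SEARCH over kernel-typed RH-EQUIVALENCES; a splitting A ∧ B ⟹ RH is CONDITIONAL bookkeeping unless A and B are
both proved; nothing here bears on the truth of RH.»
-/

set_option linter.dupNamespace false

noncomputable section

open Complex Polynomial

namespace Summit.RiemannHypothesis.RiemannHypothesis.Theorems.Splittings.JensenX4NewmanDict

open Literature Literature.NumberTheory.LFunctions
open Summit.RiemannHypothesis.RiemannHypothesis.Theorems.Splittings.JensenDerivativeLadder

/-- `H_0(w) = ξ₁(−w²/4)/8`. -/
theorem deBruijnH_zero_eq_xiSq (w : ℂ) : deBruijnH 0 w = xiSq (-(w ^ 2 / 4)) / 8 := by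
  rw [deBruijnH_zero_eq_holds w, riemannXi_eq_xiSq]
  have e : (1 / 2 + I * w / 2 - 1 / 2 : ℂ) ^ 2 = -(w ^ 2 / 4) := by
    have : (1 / 2 + I * w / 2 - 1 / 2 : ℂ) = I * w / 2 := by ring
    rw [this, div_pow, mul_pow, I_sq]; ring
  rw [e]

/-- `H_0′(z) = −(z/16) · ξ₁′(−z²/4)`. -/
theorem deriv_deBruijnH_zero (z : ℂ) :
    deriv (deBruijnH 0) z = -(z / 16) * deriv xiSq (-(z ^ 2 / 4)) := by
  have hH : deBruijnH 0 = fun w ↦ xiSq (-(w ^ 2 / 4)) / 8 := funext deBruijnH_zero_eq_xiSq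
  rw [hH]
  have hin : HasDerivAt (fun w : ℂ ↦ -(w ^ 2 / 4)) (-((2 : ℕ) * z ^ (2 - 1) / 4)) z :=
    ((hasDerivAt_pow 2 z).div_const 4).neg
  have hx : HasDerivAt xiSq (deriv xiSq (-(z ^ 2 / 4))) (-(z ^ 2 / 4)) :=
    (differentiable_xiSq.differentiableAt).hasDerivAt
  have h : HasDerivAt (fun w : ℂ ↦ xiSq (-(w ^ 2 / 4)) / 8)
      (deriv xiSq (-(z ^ 2 / 4)) * (-((2 : ℕ) * z ^ (2 - 1) / 4)) / 8) z :=
    (hx.comp z hin).div_const 8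
  rw [h.deriv]
  simp only [Nat.cast_ofNat]
  ring

/-- **KERNEL DICTIONARY.** Conjunct `A = RowsFromOne` of splitting X-4 (all Jensen polynomials of
`ξ` of every row `n ≥ 1` are hyperbolic) is equivalent to «`H_0′` has only real zeros», i.e. to
`Ξ′ ∈ 𝓛𝓟` — the `t = 0` member of the family `H_t′` all of whose `t < 0` members have non-real
zeros (`newmanDeriv`). -/
theorem rowsFromOne_iff_hasOnlyRealZeros_deriv_deBruijnH_zero :
    (∀ d n : ℕ, 1 ≤ n → (jensenPoly xiTaylorCoeff d n).Splits) ↔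
      HasOnlyRealZeros (deriv (deBruijnH 0)) := by
  rw [rowsFromOne_iff_xiRowHyperbolic_one, xiRowHyperbolic_iff_xiDerivZerosReal]
  simp only [XiDerivZerosReal, iteratedDeriv_one, HasOnlyRealZeros, deriv_deBruijnH_zero]
  constructor
  · intro h z hz
    rcases mul_eq_zero.1 hz with h1 | h2
    · have : z = 0 := by simpa using h1
      simp [this]
    · have him := h _ h2
      have hre := re_neg_of_iteratedDeriv_xiSq_eq_zero_of_im_eq_zero 1
        (by rwa [iteratedDeriv_one]) him
      simp only [Complex.neg_im, Complex.neg_re, Complex.div_ofNat_im, Complex.div_ofNat_re, sq,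
        Complex.mul_im, Complex.mul_re] at him hre
      have hprod : z.re * z.im = 0 := by linarith
      rcases mul_eq_zero.1 hprod with h0 | h0
      · exfalso
        rw [h0] at hre
        nlinarith [sq_nonneg z.im]
      · exact h0
  · intro h w hw
    have hroot : (w ^ (2⁻¹ : ℂ)) ^ 2 = w := by exact_mod_cast Complex.cpow_nat_inv_pow w two_ne_zero
    set z : ℂ := 2 * I * w ^ (2⁻¹ : ℂ) with hz
    have hz2 : z ^ 2 = -4 * w := by rw [hz, mul_pow, mul_pow, I_sq, hroot]; ring
    have hzw : -(z ^ 2 / 4) = w := by rw [hz2]; ring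
    have hzim : z.im = 0 := h z (by rw [hzw, hw, mul_zero])
    rw [← hzw]
    simp [Complex.neg_im, Complex.div_ofNat_im, sq, Complex.mul_im, hzim]

/-- The two halves side by side (no claim about which holds at `t = 0`): conjunct `A` says the
`t = 0` derivative is hyperbolic; for every `t < 0` it is not. -/
theorem rowsFromOne_iff_and_newman_flow
    (newmanDeriv : ∀ t : ℝ, t < 0 → ¬ HasOnlyRealZeros (deriv (deBruijnH t))) :
    ((∀ d n : ℕ, 1 ≤ n → (jensenPoly xiTaylorCoeff d n).Splits) ↔
        HasOnlyRealZeros (deriv (deBruijnH 0))) ∧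
      ∀ t : ℝ, HasOnlyRealZeros (deriv (deBruijnH t)) → 0 ≤ t :=
  ⟨rowsFromOne_iff_hasOnlyRealZeros_deriv_deBruijnH_zero,
    fun t ht ↦ not_lt.1 fun hlt ↦ newmanDeriv t hlt ht⟩

end Summit.RiemannHypothesis.RiemannHypothesis.Theorems.Splittings.JensenX4NewmanDict

end
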